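import Summits.QuantumFields.YangMills.Theses.FradkinShenkerFlow

/-!
# `FradkinShenkerFlow.Assembly` — the assembly item of route `FradkinShenkerFlow`

Route `FradkinShenkerFlow` (sub-problem `YangMills` of summit `QuantumFields`) files, as its assembly
item `Assembly` (stmt-QuantumFields-9447), the implication chain

`SusceptibilityToPoincare → PoincareToClustering → FiniteSusceptibilityWeakCoupling →
 ClusteringToYangMills → YangMills`.

This is *verbatim* the type of the route's deciding theorem
`Summit.QuantumFields.YangMills.Theses.FradkinShenkerFlow.closes` (planner-authored, sorry-free,
kernel-checked with the route file). Its content is pure bookkeeping: given the weak-coupling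
threshold `β₀(G, r)` of `FiniteSusceptibilityWeakCoupling`, feed `ClusteringToYangMills` with the
threshold `max β₀ 0`, so that every `β ≥ max β₀ 0` is both `≥ β₀` (finite susceptibility applies) and
`≥ 0` (so `SusceptibilityToPoincare` gives the uniform heat-bath Poincaré inequality and
`PoincareToClustering` turns it into volume-uniform exponential clustering in Euclidean time).
This file closes the item by that definitional unfolding; it adds no mathematics of its own.

Sources: route-internal (the deciding theorem `closes`); Jaffe–Witten 2000 for the clauses packaged
in `YangMills`.
Deliberately NOT here: any of the cruxes (`SusceptibilityToPoincare`,
`FiniteSusceptibilityWeakCoupling`, `ClusteringToYangMills`) or supports (`PoincareToClustering`,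
`ElitzurLinkCovariance`, `StrongPinningPoincare`) — they stay open items of the route.
-/

namespace Summit.QuantumFields.YangMills.Theorems

/-- **`FradkinShenkerFlow.Assembly` holds** (assembly item stmt-QuantumFields-9447): the chain
`SusceptibilityToPoincare → PoincareToClustering → FiniteSusceptibilityWeakCoupling →
ClusteringToYangMills → YangMills`.
Proof: after unfolding, the goal is literally the type of the route's sorry-free deciding theorem
`FradkinShenkerFlow.closes` (threshold `max β₀ 0` bookkeeping). [folklore] -/
theorem fradkinShenkerFlow_assembly_proof :
    Summit.QuantumFields.YangMills.Theses.FradkinShenkerFlow.Assembly := by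
  unfold Summit.QuantumFields.YangMills.Theses.FradkinShenkerFlow.Assembly
  exact Summit.QuantumFields.YangMills.Theses.FradkinShenkerFlow.closes

end Summit.QuantumFields.YangMills.Theorems
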